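import Summits.CriticalPhenomena.PercolationContinuityZ3.Theorems.Transplant.Bcc111ClawTable
import HarnessLib

/-!
# The bcc (111)-films `F_m(bcc)`, exit-form routing certificate V: SOUNDNESS of the leg test and of the first-fit rule `clawH` (`Prop` forms)

builds on p205010 (kernel theorem, internal audit signed; external expert review pending) — NOT used in this file.
Lane `prim-bschramm`, seat `prim-bschramm-p2` (gen 48; class C1b, METHOD = input substitution; memo `HOME/bschramm/P2-LATTICES.md` §159); helper file
(`--supports stmt-CriticalPhenomena-4575 --as helper`).  «Bcc111ClawTable» defines the first-fit rule `clawH`; «Bcc111ClawTableOK{A,…,G}» establish by kernel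
computation that it succeeds on every admissible configuration of the ten kernel classes.  This file turns the Boolean tests into propositions:
* §1 `LegProps` and **`legOK_sound`**; `penult` of a leg; the shape of the start columns (`starts_spec`); the hub slots (`mem_hubs`);
* §2 `ClawProps` (hub column among the rerouting columns, norm `≤ 2`, off the targets, extreme vertex not removed; `b`-column likewise; the three legs passing
  their tests from start columns `{X, A, B}` — one exit column and the two chain-port columns —, the entry tests of a stacked pair, pairwise column-disjointness but
  for a shared target) and **`clawH_sound`**.
[cite: DuminilCopinSidoraviciusTassion2016, §2.3 (proof of Fact 2: the three disjoint paths in B̄_R(z) ∖ {z})]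
-/

namespace Summit.CriticalPhenomena.PercolationContinuityZ3.Theorems.Transplant

namespace Bcc111Claw

open BccClawX (Pt)

/-! ## §1 The leg test, the penultimate column, the start columns, the hub slots -/

/-- **The properties of a leg** (the `Prop` form of `legOK R avoid s a l = true`). [folklore] -/
structure LegProps (R : Pt → Bool) (avoid : List Pt) (s a : Pt) (l : List Pt) : Prop where
  /-- non-empty -/
  ne_nil : l ≠ []
  /-- starts at `s` -/
  head : l.head ne_nil = s
  /-- ends at `a` -/
  last : l.getLast ne_nil = a
  /-- at least two columns -/
  two_le : 2 ≤ l.length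
  /-- consecutive columns `𝕋`-adjacent -/
  chain : l.IsChain (fun a b => adjH a b = true)
  /-- duplicate-free -/
  nodup : l.Nodup
  /-- inside the region -/
  mem_R : ∀ w ∈ l, R w = true
  /-- avoids the forbidden columns -/
  not_avoid : ∀ w ∈ l, w ∉ avoid

/-- `chainH` is `List.IsChain` for `adjH`. [folklore] -/
theorem chainH_iff : ∀ {l : List Pt}, chainH l = true ↔ l.IsChain (fun a b => adjH a b = true)
  | [] => by simp [chainH]
  | [_] => by simp [chainH]
  | a :: b :: l => by rw [chainH, Bool.and_eq_true, chainH_iff, List.isChain_cons_cons]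

/-- **Soundness of the leg test.** [folklore] -/
theorem legOK_sound {R : Pt → Bool} {avoid : List Pt} {s a : Pt} {l : List Pt} (h : legOK R avoid s a l = true) : LegProps R avoid s a l := by
  simp only [legOK, Bool.and_eq_true, beq_iff_eq, decide_eq_true_eq, List.all_eq_true, Bool.not_eq_true'] at h
  obtain ⟨⟨⟨⟨⟨hh, hl⟩, hlen⟩, hch⟩, hnd⟩, hall⟩ := h
  have hne : l ≠ [] := by rintro rfl; simp at hlen
  refine ⟨hne, by rw [List.head_eq_iff_head?_eq_some]; exact hh, by rw [List.getLast_eq_iff_getLast?_eq_some]; exact hl, hlen, chainH_iff.1 hch, hnd,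
    fun w hw => (hall w hw).1, fun w hw => ?_⟩
  have := (hall w hw).2; simpa using this

/-- The penultimate column of `l ++ [a]` is the last column of `l`. [folklore] -/
theorem penult_append_singleton {l : List Pt} (hl : l ≠ []) (a : Pt) : penult (l ++ [a]) = l.getLast hl := by
  have h1 : ((l ++ [a]).reverse.drop 1) = l.reverse := by simp
  rw [penult, h1]
  obtain ⟨x, xs, hx⟩ := List.exists_cons_of_ne_nil (List.reverse_ne_nil_iff.2 hl)
  have hl' : l = xs.reverse ++ [x] := by rw [← List.reverse_reverse l, hx]; simp
  rw [hx, List.headD_cons]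
  simp [hl']

/-- A leg splits off its target: `l = l.dropLast ++ [a]` with `l.dropLast ≠ []`, `a ∉ l.dropLast`, and `penult l` the last column of `l.dropLast`. [folklore] -/
theorem LegProps.split {R : Pt → Bool} {avoid : List Pt} {s a : Pt} {l : List Pt} (h : LegProps R avoid s a l) :
    ∃ hd : l.dropLast ≠ [], l = l.dropLast ++ [a] ∧ a ∉ l.dropLast ∧ penult l = l.dropLast.getLast hd ∧ (l.dropLast).head hd = s ∧
      (l.dropLast).IsChain (fun a b => adjH a b = true) ∧ (l.dropLast).Nodup ∧ adjH ((l.dropLast).getLast hd) a = true := by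
  have hsplit : l = l.dropLast ++ [a] := by conv_lhs => rw [← List.dropLast_append_getLast h.ne_nil, h.last]
  have hd : l.dropLast ≠ [] := by
    intro he; have := h.two_le; rw [hsplit, he] at this; simp at this
  refine ⟨hd, hsplit, ?_, ?_, ?_, ?_, h.nodup.sublist (List.dropLast_sublist l), ?_⟩
  · intro ha
    have hnd := h.nodup; rw [hsplit] at hnd
    exact (List.nodup_append.1 hnd).2.2 a ha a (List.mem_singleton_self a) rfl
  · conv_lhs => rw [hsplit]
    exact penult_append_singleton hd a
  · have := h.head
    rw [List.head_eq_iff_head?_eq_some] at this ⊢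
    rw [hsplit, List.head?_append_of_ne_nil _ hd] at this; exact this
  · have := h.chain; rw [hsplit, List.isChain_append] at this; exact this.1
  · have := h.chain; rw [hsplit, List.isChain_append] at this
    exact this.2.2 _ (by rw [List.getLast?_eq_some_getLast hd]; rfl) a (by simp)

/-- **The shape of the start columns**: a permutation placing one exit column `X ∈ {X₀, X₁}` and the two chain-port columns `A, B` (`{A, B} = {F₀, F₁}`).
[folklore] -/
theorem starts_spec (F0 F1 X0 X1 : Pt) (j k xi : ℕ) : ∃ A B X : Pt, ((A = F0 ∧ B = F1) ∨ (A = F1 ∧ B = F0)) ∧ (X = X0 ∨ X = X1) ∧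
    (starts F0 F1 X0 X1 j k xi = (X, A, B) ∨ starts F0 F1 X0 X1 j k xi = (A, X, B) ∨ starts F0 F1 X0 X1 j k xi = (A, B, X)) := by
  refine ⟨if k = 0 then F0 else F1, if k = 0 then F1 else F0, if xi = 0 then X0 else X1, ?_, ?_, ?_⟩
  · by_cases hk : k = 0 <;> simp [hk]
  · by_cases hx : xi = 0 <;> simp [hx]
  · unfold starts
    by_cases hj0 : j = 0
    · simp [hj0]
    · by_cases hj1 : j = 1
      · simp [hj1]
      · simp [hj0, hj1]

/-- The hub slots have direction index `≤ 2`. [folklore] -/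
theorem i_le_two_of_mem_hubs {Q : Pt} {i : ℕ} {up : Bool} (h : (Q, i, up) ∈ hubs) : i ≤ 2 := by
  simp only [hubs, List.mem_flatMap, List.mem_cons, List.not_mem_nil, or_false, Prod.mk.injEq] at h
  obtain ⟨q, -, hq⟩ := h
  rcases hq with ⟨-, rfl, -⟩ | ⟨-, rfl, -⟩ | ⟨-, rfl, -⟩ | ⟨-, rfl, -⟩ | ⟨-, rfl, -⟩ | ⟨-, rfl, -⟩ <;> norm_num

/-! ## §2 The properties of a claw and the soundness of the rule -/

/-- **The properties of a claw** found by `clawH` for the configuration `(a₁, a₂, a₃, ty)` of the class `(t_R, t_D, s_R, s_D)`: hub slot `(Q, i, up)` with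
its `b`-column, chain-port and exit columns `(bc, F₀, F₁, X₀, X₁) = hubCols Q i up`, the three start columns `(s₁, s₂, s₃)` — one exit column, two
chain-port columns — and the three legs. [folklore] -/
structure ClawProps (tR tD sR sD : ℕ) (a1 a2 a3 : Pt) (ty : ℕ) (Q : Pt) (i : ℕ) (up : Bool) (bc F0 F1 X0 X1 s1 s2 s3 : Pt)
    (l1 l2 l3 : List Pt) : Prop where
  /-- the hub slot's columns -/
  hh : hubCols Q i up = (bc, F0, F1, X0, X1)
  /-- direction index -/
  hi : i ≤ 2
  /-- hub column among the rerouting columns -/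
  hQ : inRB tR sR Q = true
  /-- hub column near the centre -/
  hQ2 : tnZ Q ≤ 2
  /-- hub column off the targets -/
  hQa : Q ≠ a1 ∧ Q ≠ a2 ∧ Q ≠ a3
  /-- up-hub: the bottom vertex of the hub column is not removed -/
  hQ0 : up = true → rem0 tR sR Q = false
  /-- down-hub: the top vertex of the hub column is not removed -/
  hQm : up = false → remM tR sR Q = false
  /-- `b`-column among the rerouting columns -/
  hbc : inRB tR sR bc = true
  /-- `b`-column off the targets -/
  hbca : bc ≠ a1 ∧ bc ≠ a2 ∧ bc ≠ a3
  /-- the start columns: one exit column, the two chain-port columns -/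
  hst : ∃ A B X : Pt, ((A = F0 ∧ B = F1) ∨ (A = F1 ∧ B = F0)) ∧ (X = X0 ∨ X = X1) ∧
    ((s1, s2, s3) = (X, A, B) ∨ (s1, s2, s3) = (A, X, B) ∨ (s1, s2, s3) = (A, B, X))
  /-- leg to `a₁` -/
  leg1 : LegProps (inRB tR sR) (if a1 == a2 then [Q, bc, a3] else [Q, bc, a2, a3]) s1 a1 l1
  /-- leg to `a₂` -/
  leg2 : LegProps (inRB tR sR) (if a1 == a2 then [Q, bc, a3] else [Q, bc, a1, a3]) s2 a2 l2
  /-- leg to `a₃` -/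
  leg3 : LegProps (inDB tR tD sR sD) [Q, bc, a1, a2] s3 a3 l3
  /-- entry test of the lower stacked terminal -/
  pen1 : a1 = a2 → penLo tR sR a1 (ty / 3) (penult l1) = true
  /-- entry test of the upper stacked terminal -/
  pen2 : a1 = a2 → penHi tR sR a1 (ty % 3) (penult l2) = true
  /-- legs `1, 2` meet only in a shared target -/
  d12 : ∀ w ∈ l1, w ∈ l2 → a1 = a2 ∧ w = a1
  /-- leg `3` off leg `1` -/
  d31 : ∀ w ∈ l3, w ∉ l1
  /-- leg `3` off leg `2` -/
  d32 : ∀ w ∈ l3, w ∉ l2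

/-- `disjH` in `Prop` form. [folklore] -/
theorem disjH_sound {shared : Bool} {a : Pt} {l₁ l₂ : List Pt} (h : disjH shared a l₁ l₂ = true) :
    ∀ w ∈ l₁, w ∈ l₂ → shared = true ∧ w = a := by
  intro w hw hw2
  simp only [disjH, List.all_eq_true, Bool.or_eq_true, Bool.and_eq_true, beq_iff_eq, Bool.not_eq_true'] at h
  rcases h w hw with h | h
  · exact h
  · simp [hw2] at h

/-- An `if … then none else x` equal to `some y`. [folklore] -/
private theorem ite_none_some {α : Type} {p : Prop} [Decidable p] {x : Option α} {y : α} (h : (if p then none else x) = some y) :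
    ¬ p ∧ x = some y := by
  by_cases hp : p
  · rw [if_pos hp] at h; exact absurd h (by simp)
  · rw [if_neg hp] at h; exact ⟨hp, h⟩

/-- **SOUNDNESS OF THE RULE.** [folklore] -/
theorem clawH_sound {tR tD sR sD : ℕ} {a1 a2 a3 : Pt} {ty : ℕ} {Q : Pt} {i : ℕ} {up : Bool} {j k xi : ℕ} {l1 l2 l3 : List Pt}
    (h : clawH tR tD sR sD a1 a2 a3 ty = some (Q, i, up, j, k, xi, l1, l2, l3)) :
    ∃ bc F0 F1 X0 X1 s1 s2 s3 : Pt, ClawProps tR tD sR sD a1 a2 a3 ty Q i up bc F0 F1 X0 X1 s1 s2 s3 l1 l2 l3 := by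
  unfold clawH at h
  obtain ⟨⟨Q', i', up'⟩, hQmem, hQ⟩ := List.exists_of_findSome?_eq_some h
  simp only at hQ
  generalize hh : hubCols Q' i' up' = hc at hQ
  obtain ⟨bc, F0, F1, X0, X1⟩ := hc
  simp only at hQ
  obtain ⟨hcond, hQ'⟩ := ite_none_some hQ
  obtain ⟨⟨j', k', xi'⟩, -, hA⟩ := List.exists_of_findSome?_eq_some hQ'
  simp only at hA
  generalize hs : starts F0 F1 X0 X1 j' k' xi' = st at hA
  obtain ⟨s1, s2, s3⟩ := st
  simp only at hA
  obtain ⟨m1, hm1, h1⟩ := List.exists_of_findSome?_eq_some hA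
  obtain ⟨m2, hm2, h2⟩ := List.exists_of_findSome?_eq_some h1
  rw [List.mem_filter] at hm1 hm2
  obtain ⟨hdisj, h2'⟩ := ite_none_some h2
  simp only [Option.map_eq_some_iff] at h2'
  obtain ⟨m3, hm3, hx⟩ := h2'
  have hp3 := List.find?_some hm3
  have hm3' := List.mem_of_find?_eq_some hm3
  rw [List.mem_filter] at hm3'
  simp only [Prod.mk.injEq] at hx
  obtain ⟨rfl, rfl, rfl, rfl, rfl, rfl, rfl, rfl, rfl⟩ := hx
  simp only [Bool.or_eq_true, Bool.not_eq_true', beq_iff_eq, Bool.and_eq_true, Bool.not_eq_false, not_or,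
    decide_eq_false_iff_not, not_le, beq_eq_false_iff_ne, ne_eq, not_lt] at hcond hm1 hm2 hm3' hp3 hdisj
  have hsame : (a1 == a2) = true ↔ a1 = a2 := beq_iff_eq
  refine ⟨bc, F0, F1, X0, X1, s1, s2, s3, hh, i_le_two_of_mem_hubs hQmem, ?_, ?_, ?_, ?_, ?_, ?_, ?_, by rw [← hs]; exact starts_spec _ _ _ _ _ _ _,
    ?_, ?_, legOK_sound hm3'.2, ?_, ?_, ?_, ?_, ?_⟩
  · simpa using hcond.1.1.1.1.1.1.1.1.1.1
  · exact hcond.1.1.1.1.1.1.1.1.1.2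
  · exact ⟨hcond.1.1.1.1.1.1.1.1.2, hcond.1.1.1.1.1.1.1.2, hcond.1.1.1.1.1.1.2⟩
  · intro hup; have := hcond.1.1.1.1.1.2; simp [hup] at this; simpa using this
  · intro hup; have := hcond.1.1.1.1.2; simp [hup] at this; simpa using this
  · simpa using hcond.1.1.1.2
  · exact ⟨hcond.1.1.2, hcond.1.2, hcond.2⟩
  · simpa using legOK_sound hm1.2.1
  · simpa using legOK_sound hm2.2.1
  · intro he
    rcases hm1.2.2 with hne | hp
    · exact absurd (hsame.2 he) (by simp [hne])
    · exact hp
  · intro he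
    rcases hm2.2.2 with hne | hp
    · exact absurd (hsame.2 he) (by simp [hne])
    · exact hp
  · intro w hw hw2
    have := disjH_sound hdisj w hw hw2
    exact ⟨hsame.1 this.1, this.2⟩
  · intro w hw hw1
    have := disjH_sound hp3.1 w hw hw1
    simp at this
  · intro w hw hw2
    have := disjH_sound hp3.2 w hw hw2
    simp at this

end Bcc111Claw

end Summit.CriticalPhenomena.PercolationContinuityZ3.Theorems.Transplant
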